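import Mathlib
import HarnessLib

/-!
# [IUTchIII] Cor. 3.12, Team R ramified-mover thread — the place `λ = ζ₃ − 1` of `ℚ(ζ₃)` and the
# coordinate swap `A + Bλ ↦ B + Aλ`

Definition-bearing data file of the abc-iut cell (Cor. 3.12 STRATEGY TEAM R, lead R1 =
abc-iut-c312-14; the «ramified non-rational-multiple mover» thread of `Cor312IdentifiedIndFixes`
p418763, kit `Cor312IdentifiedMoverKit` p424851); TAKES NO SIDE on [IUTchIII] Cor. 3.12.
Everything here is classical algebraic number theory at the third cyclotomic field ([folklore]).

`K₃ := ℚ(ζ₃)` is ramified over `3`: `λ := ζ₃ − 1` satisfies `λ² = −3ζ₃`, so at the place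
`v₃ := (λ)` one has `v₃(λ)² = v₃(3)` — `v₃(λ)` is an ODD («half-integral») power of the
uniformizer scale, hence NOT the valuation of any rational number
(`val3_ratCast_ne_val3_lam`, the parity lemma). This file provides, for the kit's
completion-extension machinery (`Cor312IdentifiedMoverKit`):

* the field `K3`, `zeta3`, `lam`, the identities `zeta3_sq_add` (`ζ² + ζ + 1 = 0`) and
  `lam_sq` (`λ² = −3ζ`), and the prime `lamInt = ζ₃ − 1` of `𝒪_{K₃}`
  (Mathlib `IsPrimitiveRoot.zeta_sub_one_prime'`) with its place `v3 : HeightOneSpectrum (𝓞 K3)`;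
* the `ℚ`-basis `{1, λ}` (`basisLam`) with coordinate functionals `coordA`, `coordB`, and the
  COORDINATE SWAP `sSwap : A + Bλ ↦ B + Aλ` — a `ℚ`-linear involution (`sSwap_invol`) exchanging
  `1 ↔ λ` (`sSwap_one`, `sSwap_lam`) and mapping the image of `𝓞 K3` into itself
  (`sSwap_image_int`: in the `λ`-basis the ring of integers is the `ℤ`-lattice `ℤ ⊕ ℤλ`, via
  `𝓞 K3 = ℤ[ζ₃]`, Mathlib `IsCyclotomicExtension.Rat.isIntegralClosure_adjoin_singleton_of_prime`);
* (continued in `Cor312RamifiedPlaceValuation.lean`: the place `v3`, the valuation parity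
  lemmas, the ultrametric max formula, the boundedness of the swap, and the integer lattice.)

Consumer: `Cor312IdentifiedRamifiedMover.lean` feeds these into the kit and derives the
`Real.ismDH` mover of the p418763 docstring signature. Every statement is about the third
cyclotomic field only; nothing here bears on the dispute. [folklore] throughout; standard axioms.
-/

noncomputable section

namespace Summit.ABC.IUTFork.RamifiedMover

open IsDedekindDomain IsDedekindDomain.HeightOneSpectrum NumberField Module
open scoped Pointwise

/-- The cyclotomic-extension instance, supplied explicitly (instance synthesis does not fire for
the numeral `3` at this Mathlib pin; the named instance applies). [folklore] -/
theorem cycInst : IsCyclotomicExtension {3} ℚ (CyclotomicField 3 ℚ) :=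
  CyclotomicField.isCyclotomicExtension 3 ℚ

/-! ## 1. The field `ℚ(ζ₃)`, `λ = ζ₃ − 1`, and the basic identities -/

/-- The third cyclotomic field `K₃ = ℚ(ζ₃)`. [folklore] -/
abbrev K3 : Type := CyclotomicField 3 ℚ

/-- A fixed primitive third root of unity `ζ₃ ∈ K₃`. [folklore] -/
def zeta3 : K3 :=
  letI := cycInst
  IsCyclotomicExtension.zeta 3 ℚ (CyclotomicField 3 ℚ)

/-- `ζ₃` is a primitive third root of unity. [folklore] -/
theorem zeta3_spec : IsPrimitiveRoot zeta3 3 :=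
  letI := cycInst
  IsCyclotomicExtension.zeta_spec 3 ℚ (CyclotomicField 3 ℚ)

/-- `λ := ζ₃ − 1`, a uniformizer of the unique (ramified) place of `K₃` above `3`. [folklore] -/
def lam : K3 := zeta3 - 1

/-- `ζ₃³ = 1`. [folklore] -/
theorem zeta3_pow_three : zeta3 ^ 3 = 1 := zeta3_spec.pow_eq_one

/-- `ζ₃ ≠ 1`. [folklore] -/
theorem zeta3_ne_one : zeta3 ≠ 1 := zeta3_spec.ne_one (by norm_num)

/-- `λ ≠ 0`. [folklore] -/
theorem lam_ne_zero : lam ≠ 0 := sub_ne_zero.mpr zeta3_ne_one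

/-- `ζ₃² + ζ₃ + 1 = 0`. [folklore] -/
theorem zeta3_sq_add : zeta3 ^ 2 + zeta3 + 1 = 0 := by
  have hfac : (zeta3 - 1) * (zeta3 ^ 2 + zeta3 + 1) = 0 := by
    linear_combination zeta3_pow_three
  rcases mul_eq_zero.mp hfac with h | h
  · exact absurd (sub_eq_zero.mp h) zeta3_ne_one
  · exact h

/-- **The ramification identity** `λ² = −3·ζ₃`. [folklore] -/
theorem lam_sq : lam ^ 2 = -3 * zeta3 := by
  simp only [lam]
  linear_combination zeta3_sq_add

/-- `3 = −λ²·ζ₃²` — in particular `λ ∣ 3`. [folklore] -/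
theorem three_eq_lam : (3 : K3) = -(lam ^ 2) * zeta3 ^ 2 := by
  rw [lam_sq]
  linear_combination (-3 : K3) * zeta3_pow_three

/-- Rational scalars act by cast-multiplication. [folklore] -/
theorem ratCast_smul_eq (q : ℚ) (x : K3) : q • x = (q : K3) * x := by
  rw [Algebra.smul_def, eq_ratCast (algebraMap ℚ K3) q]

/-! ## 2. The basis `{1, λ}`, the coordinates, and the swap -/

/-- `K₃` has degree `2` over `ℚ`. [folklore] -/
theorem finrank_K3 : Module.finrank ℚ K3 = 2 := by
  haveI := cycInst
  rw [IsCyclotomicExtension.finrank (n := 3) K3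
    (Polynomial.cyclotomic.irreducible_rat (by norm_num))]
  rw [Nat.totient_prime (by norm_num)]

/-- No rational cube root of unity except `1`. [folklore] -/
theorem rat_cube_eq_one {r : ℚ} (hr : r ^ 3 = 1) : r = 1 := by
  have hfac : (r - 1) * (r ^ 2 + r + 1) = 0 := by linear_combination hr
  rcases mul_eq_zero.mp hfac with h | h
  · exact sub_eq_zero.mp h
  · nlinarith [sq_nonneg (r + 1/2), sq_nonneg r]

/-- `λ` is irrational: no `a : ℚ` has `(a : K₃) = λ`. [folklore] -/
theorem lam_ne_ratCast (a : ℚ) : (a : K3) ≠ lam := by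
  intro h
  have hz : zeta3 = ((1 + a : ℚ) : K3) := by
    push_cast
    rw [h]
    simp [lam]
  have h3 : ((1 + a : ℚ) : K3) ^ 3 = 1 := by rw [← hz]; exact zeta3_pow_three
  have h3' : ((1 + a) ^ 3 : ℚ) = 1 := by exact_mod_cast h3
  have ha : (1 + a : ℚ) = 1 := rat_cube_eq_one h3'
  refine zeta3_ne_one ?_
  rw [hz, ha]
  norm_num

/-- `{1, λ}` is `ℚ`-linearly independent. [folklore] -/
theorem linearIndependent_one_lam : LinearIndependent ℚ ![(1 : K3), lam] := by
  rw [LinearIndependent.pair_iff]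
  intro p t hst
  rw [ratCast_smul_eq, ratCast_smul_eq, mul_one] at hst
  by_cases ht : t = 0
  · subst ht
    refine ⟨?_, rfl⟩
    rw [Rat.cast_zero, zero_mul, add_zero] at hst
    exact_mod_cast hst
  · exfalso
    have htK : (t : K3) ≠ 0 := by exact_mod_cast ht
    refine lam_ne_ratCast (-p / t) ?_
    push_cast
    rw [div_eq_iff htK]
    linear_combination -hst

/-- The `ℚ`-basis `{1, λ}` of `K₃`. [folklore] -/
def basisLam : Basis (Fin 2) ℚ K3 :=
  basisOfLinearIndependentOfCardEqFinrank linearIndependent_one_lam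
    (by rw [finrank_K3]; simp)

/-- `basisLam` is the pair `{1, λ}`, as a function. [folklore] -/
theorem basisLam_coe : ⇑basisLam = ![(1 : K3), lam] :=
  coe_basisOfLinearIndependentOfCardEqFinrank _ _

/-- `basisLam 0 = 1`. [folklore] -/
theorem basisLam_zero : basisLam 0 = 1 := by rw [basisLam_coe]; rfl

/-- `basisLam 1 = λ`. [folklore] -/
theorem basisLam_one : basisLam 1 = lam := by rw [basisLam_coe]; rfl

/-- The first coordinate `A` in `x = A + Bλ`. [folklore] -/
def coordA : K3 →ₗ[ℚ] ℚ := basisLam.coord 0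

/-- The second coordinate `B` in `x = A + Bλ`. [folklore] -/
def coordB : K3 →ₗ[ℚ] ℚ := basisLam.coord 1

/-- `A(1) = 1`. [folklore] -/
theorem coordA_one : coordA 1 = 1 := by
  rw [coordA, ← basisLam_zero, Basis.coord_apply, Basis.repr_self, Finsupp.single_eq_same]

/-- `A(λ) = 0`. [folklore] -/
theorem coordA_lam : coordA lam = 0 := by
  rw [coordA, ← basisLam_one, Basis.coord_apply, Basis.repr_self]
  exact Finsupp.single_eq_of_ne (by decide)

/-- `B(1) = 0`. [folklore] -/
theorem coordB_one : coordB 1 = 0 := by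
  rw [coordB, ← basisLam_zero, Basis.coord_apply, Basis.repr_self]
  exact Finsupp.single_eq_of_ne (by decide)

/-- `B(λ) = 1`. [folklore] -/
theorem coordB_lam : coordB lam = 1 := by
  rw [coordB, ← basisLam_one, Basis.coord_apply, Basis.repr_self, Finsupp.single_eq_same]

/-- The coordinate expansion `x = A(x)·1 + B(x)·λ`. [folklore] -/
theorem expansion (x : K3) : coordA x • (1 : K3) + coordB x • lam = x := by
  have h := basisLam.sum_repr x
  rw [Fin.sum_univ_two] at h
  rw [coordA, coordB, Basis.coord_apply, Basis.coord_apply, ← basisLam_zero, ← basisLam_one]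
  exact h

/-- `A` on an explicit combination. [folklore] -/
theorem coordA_combo (p q : ℚ) : coordA ((p : K3) + q • lam) = p := by
  have h1 : (p : K3) = p • (1 : K3) := by rw [ratCast_smul_eq, mul_one]
  rw [h1, map_add, map_smul, map_smul, coordA_one, coordA_lam, smul_eq_mul, smul_eq_mul,
    mul_one, mul_zero, add_zero]

/-- `B` on an explicit combination. [folklore] -/
theorem coordB_combo (p q : ℚ) : coordB ((p : K3) + q • lam) = q := by
  have h1 : (p : K3) = p • (1 : K3) := by rw [ratCast_smul_eq, mul_one]
  rw [h1, map_add, map_smul, map_smul, coordB_one, coordB_lam, smul_eq_mul, smul_eq_mul,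
    mul_zero, mul_one, zero_add]

/-- **The coordinate swap** `A + Bλ ↦ B + Aλ`, as a `ℚ`-linear map. [folklore] -/
def sSwapLin : K3 →ₗ[ℚ] K3 :=
  LinearMap.smulRight coordB (1 : K3) + LinearMap.smulRight coordA lam

/-- The swap, as an additive map (the kit's input). [folklore] -/
def sSwap : K3 →+ K3 := sSwapLin.toAddMonoidHom

/-- The swap, unfolded. [folklore] -/
theorem sSwap_apply (x : K3) : sSwap x = coordB x • (1 : K3) + coordA x • lam := rfl

/-- The swap on an explicit combination. [folklore] -/
theorem sSwap_combo (p q : ℚ) : sSwap ((p : K3) + q • lam) = (q : K3) + p • lam := by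
  rw [sSwap_apply, coordA_combo, coordB_combo]
  congr 1
  rw [ratCast_smul_eq, mul_one]

/-- Every `x` is an explicit combination of its coordinates. [folklore] -/
theorem eq_combo (x : K3) : x = ((coordA x : ℚ) : K3) + coordB x • lam := by
  conv_lhs => rw [← expansion x]
  congr 1
  rw [ratCast_smul_eq, mul_one]

/-- `s(1) = λ`. [folklore] -/
theorem sSwap_one : sSwap 1 = lam := by
  have h : (1 : K3) = ((1 : ℚ) : K3) + (0 : ℚ) • lam := by
    rw [ratCast_smul_eq]
    push_cast
    ring
  rw [h, sSwap_combo, ratCast_smul_eq]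
  push_cast
  ring

/-- `s(λ) = 1`. [folklore] -/
theorem sSwap_lam : sSwap lam = 1 := by
  have h : lam = ((0 : ℚ) : K3) + (1 : ℚ) • lam := by
    rw [ratCast_smul_eq]
    push_cast
    ring
  rw [h, sSwap_combo, ratCast_smul_eq]
  push_cast
  ring

/-- **The swap is an involution.** [folklore] -/
theorem sSwap_invol (x : K3) : sSwap (sSwap x) = x := by
  conv_lhs => rw [eq_combo x, sSwap_combo, sSwap_combo]
  exact (eq_combo x).symm

end Summit.ABC.IUTFork.RamifiedMover

end
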